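import Mathlib
import Summits.Ventures.PercRepro2.CoinChainXAClosedGateGenAlg
import Summits.Ventures.PercRepro2.CoinChainXAClosedGateGenSums

/-!
# The CLOSED GATE of (XA′) is a theorem for EVERY entry structure and EVERY pair of markers
(blind cell PercRepro2, night-2 g30)

CoinChainXAClosedGate.lean proved the closed gate for markers vanishing on the entry-free ideal.
Here the restriction is removed: for ARBITRARY nonnegative increasing markers `x, y ≤ 1` the
cleared (XA′) `Cross ≤ a0·U001` holds at `d' ≡ 0` (`chain_XA'_closed_gate_gen`), given a positive
ideal mass.  Proof: shift the markers by their ideal means — the cleared (XA′) is shift-invariant,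
the ideal's single-marker masses vanish and its `xy`-mass becomes the covariance `a·XYI − XI·YI ≥ 0`
(FKG on the ideal, a sublattice); the shifted killed masses `X̃J = a·XJ − XI·δ`, … satisfy the
Holley facts of the parts model (now with the ideal's marker mass inside the down-set `𝒥`, and
the three new facts `I ≼ D′`, `I ≼ 𝒰`, `I ≼ M`), so `cg_parts` applies when `X̃J, ỸJ ≥ 0` and
`cg_parts_onesided` otherwise; `cg_gen_identity` assembles.
-/

namespace Summit.Ventures.PercRepro2.Coin

open Classical

section ClosedGateGenMain

variable {V : Type*} [DecidableEq V] {R : Type*} [Field R] [LinearOrder R] [IsStrictOrderedRing R]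

set_option maxHeartbeats 1600000 in
/-- **THE CLOSED GATE OF (XA′) FOR EVERY ENTRY STRUCTURE AND EVERY PAIR OF MARKERS**: for
arbitrary `ent`, `ent'`, nonnegative increasing markers `x, y ≤ 1` and a positive ideal mass, the
cleared (XA′) `Cross ≤ a0·U001` with the gate `d' ≡ 0` — the hypothesis `hXA'` of
`chain_functional_nonneg_of_XA'` at `d' := fun _ => 0`.  Needs `ν` log-supermodular, `0 ≤ d ≤ c`,
`c` log-supermodular (FKG on the ideal), the cross inequality `(c, d)` and the ratio monotonicity
of `d / c`. -/
theorem chain_XA'_closed_gate_gen (U ent ent' : Finset V) (ν c d : Finset V → R)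
    (hν0 : ∀ W, 0 ≤ ν W) (hν : ∀ s ⊆ U, ∀ t ⊆ U, ν s * ν t ≤ ν (s ∩ t) * ν (s ∪ t))
    (hc0 : ∀ W, 0 ≤ c W) (hd0 : ∀ W, 0 ≤ d W) (hdc : ∀ W, d W ≤ c W)
    (hcc : ∀ s t, c s * c t ≤ c (s ∩ t) * c (s ∪ t))
    (hcd : ∀ s t, c s * d t ≤ c (s ∩ t) * d (s ∪ t))
    (hratio : ∀ s t, s ⊆ t → d s * c t ≤ c s * d t)
    (x y : Finset V → R) (hx0 : ∀ W, 0 ≤ x W) (hy0 : ∀ W, 0 ≤ y W)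
    (hx1 : ∀ W, x W ≤ 1)
    (hxm : ∀ s t, x s ≤ x (s ∪ t)) (hym : ∀ s t, y s ≤ y (s ∪ t))
    (hmI : 0 < ∑ W ∈ U.powerset.filter (fun W => ¬ ∃ r ∈ ent ∪ ent', r ∈ W), ν W * c W) :
    (((∑ W ∈ U.powerset, ν W * chainMix ent ent' 0 c d W) * (∑ W ∈ U.powerset, ν W * chainMix ent ent' 1 c d W * x W) - (∑ W ∈ U.powerset, ν W * chainMix ent ent' 0 c d W * x W) * (∑ W ∈ U.powerset, ν W * chainMix ent ent' 1 c d W)) *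
          ((∑ W ∈ U.powerset, ν W * chainMix ent ent' 0 c d W) * (∑ W ∈ U.powerset, ν W * chainMix ent ent' 0 c (fun _ => (0 : R)) W * y W) - (∑ W ∈ U.powerset, ν W * chainMix ent ent' 0 c d W * y W) * (∑ W ∈ U.powerset, ν W * chainMix ent ent' 0 c (fun _ => (0 : R)) W))
        + ((∑ W ∈ U.powerset, ν W * chainMix ent ent' 0 c d W) * (∑ W ∈ U.powerset, ν W * chainMix ent ent' 1 c d W * y W) - (∑ W ∈ U.powerset, ν W * chainMix ent ent' 0 c d W * y W) * (∑ W ∈ U.powerset, ν W * chainMix ent ent' 1 c d W)) *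
          ((∑ W ∈ U.powerset, ν W * chainMix ent ent' 0 c d W) * (∑ W ∈ U.powerset, ν W * chainMix ent ent' 0 c (fun _ => (0 : R)) W * x W) - (∑ W ∈ U.powerset, ν W * chainMix ent ent' 0 c d W * x W) * (∑ W ∈ U.powerset, ν W * chainMix ent ent' 0 c (fun _ => (0 : R)) W))) ≤
        (∑ W ∈ U.powerset, ν W * chainMix ent ent' 0 c d W) * ((∑ W ∈ U.powerset, ν W * chainMix ent ent' 0 c d W) * (∑ W ∈ U.powerset, ν W * chainMix ent ent' 0 c d W) * (∑ W ∈ U.powerset, ν W * chainMix ent ent' 1 c (fun _ => (0 : R)) W * (x W * y W))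
          - (∑ W ∈ U.powerset, ν W * chainMix ent ent' 0 c d W) * (∑ W ∈ U.powerset, ν W * chainMix ent ent' 0 c d W * y W) * (∑ W ∈ U.powerset, ν W * chainMix ent ent' 1 c (fun _ => (0 : R)) W * x W)
          - (∑ W ∈ U.powerset, ν W * chainMix ent ent' 0 c d W) * (∑ W ∈ U.powerset, ν W * chainMix ent ent' 0 c d W * x W) * (∑ W ∈ U.powerset, ν W * chainMix ent ent' 1 c (fun _ => (0 : R)) W * y W)
          + (∑ W ∈ U.powerset, ν W * chainMix ent ent' 0 c d W * x W) * (∑ W ∈ U.powerset, ν W * chainMix ent ent' 0 c d W * y W) * (∑ W ∈ U.powerset, ν W * chainMix ent ent' 1 c (fun _ => (0 : R)) W)) := by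
  have hxy : ∑ W ∈ U.powerset, ν W * chainMix ent ent' 1 c (fun _ => (0 : R)) W * (x W * y W) =
      ∑ W ∈ U.powerset.filter (fun W => ¬ ∃ r ∈ ent ∪ ent', r ∈ W), ν W * c W * (x W * y W) :=
    cg_mom1c U ent ent' ν c (fun W => x W * y W)
  rw [cg_a0 U ent ent' ν c d, cg_mom0 U ent ent' ν c d x, cg_mom0 U ent ent' ν c d y,
    cg_b0 U ent ent' ν c d, cg_mom1 U ent ent' ν c d x, cg_mom1 U ent ent' ν c d y,
    cg_e0 U ent ent' ν c, cg_mom0c U ent ent' ν c x, cg_mom0c U ent ent' ν c y,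
    cg_g0 U ent ent' ν c, cg_mom1c U ent ent' ν c x, cg_mom1c U ent ent' ν c y, hxy,
    cg_split' U ν c d (fun W => (¬ ∃ r ∈ ent, r ∈ W) ∧ ∃ r ∈ ent', r ∈ W),
    cg_split U ν c d (fun W => (¬ ∃ r ∈ ent, r ∈ W) ∧ ∃ r ∈ ent', r ∈ W) x,
    cg_split U ν c d (fun W => (¬ ∃ r ∈ ent, r ∈ W) ∧ ∃ r ∈ ent', r ∈ W) y]
  -- the thirteen part sums
  set a := ∑ W ∈ U.powerset.filter (fun W => ¬ ∃ r ∈ ent ∪ ent', r ∈ W), ν W * c W with ha_def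
  set XI := ∑ W ∈ U.powerset.filter (fun W => ¬ ∃ r ∈ ent ∪ ent', r ∈ W), ν W * c W * x W with hXI_def
  set YI := ∑ W ∈ U.powerset.filter (fun W => ¬ ∃ r ∈ ent ∪ ent', r ∈ W), ν W * c W * y W with hYI_def
  set XYI := ∑ W ∈ U.powerset.filter (fun W => ¬ ∃ r ∈ ent ∪ ent', r ∈ W), ν W * c W * (x W * y W) with hXYI_def
  set δ := ∑ W ∈ U.powerset.filter (fun W => (¬ ∃ r ∈ ent, r ∈ W) ∧ ∃ r ∈ ent', r ∈ W), ν W * (c W - d W) with hδ_def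
  set u := ∑ W ∈ U.powerset.filter (fun W => (¬ ∃ r ∈ ent, r ∈ W) ∧ ∃ r ∈ ent', r ∈ W), ν W * d W with hu_def
  set t := ∑ W ∈ U.powerset.filter (fun W => ∃ r ∈ ent, r ∈ W), ν W * d W with ht_def
  set XJ := ∑ W ∈ U.powerset.filter (fun W => (¬ ∃ r ∈ ent, r ∈ W) ∧ ∃ r ∈ ent', r ∈ W), ν W * (c W - d W) * x W with hXJ_def
  set XU := ∑ W ∈ U.powerset.filter (fun W => (¬ ∃ r ∈ ent, r ∈ W) ∧ ∃ r ∈ ent', r ∈ W), ν W * d W * x W with hXU_def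
  set XM := ∑ W ∈ U.powerset.filter (fun W => ∃ r ∈ ent, r ∈ W), ν W * d W * x W with hXM_def
  set YJ := ∑ W ∈ U.powerset.filter (fun W => (¬ ∃ r ∈ ent, r ∈ W) ∧ ∃ r ∈ ent', r ∈ W), ν W * (c W - d W) * y W with hYJ_def
  set YU := ∑ W ∈ U.powerset.filter (fun W => (¬ ∃ r ∈ ent, r ∈ W) ∧ ∃ r ∈ ent', r ∈ W), ν W * d W * y W with hYU_def
  set YM := ∑ W ∈ U.powerset.filter (fun W => ∃ r ∈ ent, r ∈ W), ν W * d W * y W with hYM_def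
  -- nonnegativity and the box
  have hcd0 : ∀ W, 0 ≤ c W - d W := fun W => by linarith [hdc W]
  have ha : 0 < a := hmI
  have hXI : 0 ≤ XI := Finset.sum_nonneg (fun W _ => mul_nonneg (mul_nonneg (hν0 W) (hc0 W)) (hx0 W))
  have hYI : 0 ≤ YI := Finset.sum_nonneg (fun W _ => mul_nonneg (mul_nonneg (hν0 W) (hc0 W)) (hy0 W))
  have hδ : 0 ≤ δ := Finset.sum_nonneg (fun W _ => mul_nonneg (hν0 W) (hcd0 W))
  have hu : 0 ≤ u := Finset.sum_nonneg (fun W _ => mul_nonneg (hν0 W) (hd0 W))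
  have ht : 0 ≤ t := Finset.sum_nonneg (fun W _ => mul_nonneg (hν0 W) (hd0 W))
  have hXJδ : XJ ≤ δ := Finset.sum_le_sum (fun W _ =>
    mul_le_of_le_one_right (mul_nonneg (hν0 W) (hcd0 W)) (hx1 W))
  have hXUu : XU ≤ u := Finset.sum_le_sum (fun W _ =>
    mul_le_of_le_one_right (mul_nonneg (hν0 W) (hd0 W)) (hx1 W))
  have hXMt : XM ≤ t := Finset.sum_le_sum (fun W _ =>
    mul_le_of_le_one_right (mul_nonneg (hν0 W) (hd0 W)) (hx1 W))
  -- the Holley facts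
  have FJUx := cg_fact_JU' U ent ent' ν c d hν0 hν hc0 hd0 hdc hcd hratio x hx0 hxm
  have FJMx := cg_fact_JM' U ent ent' ν c d hν0 hν hc0 hd0 hdc hcd hratio x hx0 hxm
  have FJUy := cg_fact_JU' U ent ent' ν c d hν0 hν hc0 hd0 hdc hcd hratio y hy0 hym
  have FJMy := cg_fact_JM' U ent ent' ν c d hν0 hν hc0 hd0 hdc hcd hratio y hy0 hym
  rw [cg_entfree_piecewise U ent ent' ν c d x, cg_entfree_piecewise' U ent ent' ν c d] at FJUx FJMx
  rw [cg_entfree_piecewise U ent ent' ν c d y, cg_entfree_piecewise' U ent ent' ν c d] at FJUy FJMy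
  have hIM : ∀ s ⊆ U, ∀ t ⊆ U, (¬ ∃ r ∈ ent ∪ ent', r ∈ s) → (∃ r ∈ ent, r ∈ t) →
      (¬ ∃ r ∈ ent ∪ ent', r ∈ s ∩ t) ∧ (∃ r ∈ ent, r ∈ s ∪ t) := fun s _ t _ hs ht' =>
    ⟨fun ⟨r, hr, hrW⟩ => hs ⟨r, hr, (Finset.mem_inter.1 hrW).1⟩,
      by obtain ⟨r, hr, hrW⟩ := ht'; exact ⟨r, hr, Finset.mem_union.2 (Or.inr hrW)⟩⟩
  have hID : ∀ s ⊆ U, ∀ t ⊆ U, (¬ ∃ r ∈ ent ∪ ent', r ∈ s) → ((¬ ∃ r ∈ ent, r ∈ t) ∧ ∃ r ∈ ent', r ∈ t) →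
      (¬ ∃ r ∈ ent ∪ ent', r ∈ s ∩ t) ∧ ((¬ ∃ r ∈ ent, r ∈ s ∪ t) ∧ ∃ r ∈ ent', r ∈ s ∪ t) := fun s _ t _ hs ht' =>
    ⟨fun ⟨r, hr, hrW⟩ => hs ⟨r, hr, (Finset.mem_inter.1 hrW).1⟩,
      ⟨fun ⟨r, hr, hrW⟩ => (Finset.mem_union.1 hrW).elim (fun h => hs ⟨r, Finset.mem_union.2 (Or.inl hr), h⟩)
          (fun h => ht'.1 ⟨r, hr, h⟩),
        by obtain ⟨r, hr, hrW⟩ := ht'.2; exact ⟨r, hr, Finset.mem_union.2 (Or.inr hrW)⟩⟩⟩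
  have hEM : ∀ s ⊆ U, ∀ t ⊆ U, (¬ ∃ r ∈ ent, r ∈ s) → (∃ r ∈ ent, r ∈ t) →
      (¬ ∃ r ∈ ent, r ∈ s ∩ t) ∧ (∃ r ∈ ent, r ∈ s ∪ t) := fun s _ t _ hs ht' =>
    ⟨fun ⟨r, hr, hrW⟩ => hs ⟨r, hr, (Finset.mem_inter.1 hrW).1⟩,
      by obtain ⟨r, hr, hrW⟩ := ht'; exact ⟨r, hr, Finset.mem_union.2 (Or.inr hrW)⟩⟩
  have FIMx := cg_fact_cd U ν c d hν0 hν hc0 hd0 hcd x hx0 hxm (fun W => ¬ ∃ r ∈ ent ∪ ent', r ∈ W) (fun W => ∃ r ∈ ent, r ∈ W) (fun W => ¬ ∃ r ∈ ent ∪ ent', r ∈ W) (fun W => ∃ r ∈ ent, r ∈ W) hIM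
  have FIMy := cg_fact_cd U ν c d hν0 hν hc0 hd0 hcd y hy0 hym (fun W => ¬ ∃ r ∈ ent ∪ ent', r ∈ W) (fun W => ∃ r ∈ ent, r ∈ W) (fun W => ¬ ∃ r ∈ ent ∪ ent', r ∈ W) (fun W => ∃ r ∈ ent, r ∈ W) hIM
  have FIUx := cg_fact_cd U ν c d hν0 hν hc0 hd0 hcd x hx0 hxm (fun W => ¬ ∃ r ∈ ent ∪ ent', r ∈ W) (fun W => (¬ ∃ r ∈ ent, r ∈ W) ∧ ∃ r ∈ ent', r ∈ W) (fun W => ¬ ∃ r ∈ ent ∪ ent', r ∈ W) (fun W => (¬ ∃ r ∈ ent, r ∈ W) ∧ ∃ r ∈ ent', r ∈ W) hID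
  have FIUy := cg_fact_cd U ν c d hν0 hν hc0 hd0 hcd y hy0 hym (fun W => ¬ ∃ r ∈ ent ∪ ent', r ∈ W) (fun W => (¬ ∃ r ∈ ent, r ∈ W) ∧ ∃ r ∈ ent', r ∈ W) (fun W => ¬ ∃ r ∈ ent ∪ ent', r ∈ W) (fun W => (¬ ∃ r ∈ ent, r ∈ W) ∧ ∃ r ∈ ent', r ∈ W) hID
  have FIDx := cg_fact_cc U ν c hν0 hν hc0 hcc x hx0 hxm (fun W => ¬ ∃ r ∈ ent ∪ ent', r ∈ W) (fun W => (¬ ∃ r ∈ ent, r ∈ W) ∧ ∃ r ∈ ent', r ∈ W) (fun W => ¬ ∃ r ∈ ent ∪ ent', r ∈ W) (fun W => (¬ ∃ r ∈ ent, r ∈ W) ∧ ∃ r ∈ ent', r ∈ W) hID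
  have FIDy := cg_fact_cc U ν c hν0 hν hc0 hcc y hy0 hym (fun W => ¬ ∃ r ∈ ent ∪ ent', r ∈ W) (fun W => (¬ ∃ r ∈ ent, r ∈ W) ∧ ∃ r ∈ ent', r ∈ W) (fun W => ¬ ∃ r ∈ ent ∪ ent', r ∈ W) (fun W => (¬ ∃ r ∈ ent, r ∈ W) ∧ ∃ r ∈ ent', r ∈ W) hID
  have FMx := cg_fact_cd U ν c d hν0 hν hc0 hd0 hcd x hx0 hxm (fun W => ¬ ∃ r ∈ ent, r ∈ W) (fun W => ∃ r ∈ ent, r ∈ W) (fun W => ¬ ∃ r ∈ ent, r ∈ W) (fun W => ∃ r ∈ ent, r ∈ W) hEM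
  have FMy := cg_fact_cd U ν c d hν0 hν hc0 hd0 hcd y hy0 hym (fun W => ¬ ∃ r ∈ ent, r ∈ W) (fun W => ∃ r ∈ ent, r ∈ W) (fun W => ¬ ∃ r ∈ ent, r ∈ W) (fun W => ∃ r ∈ ent, r ∈ W) hEM
  rw [sum_entfree_split U ent ent' (fun W => ν W * c W * x W), sum_entfree_split U ent ent' (fun W => ν W * c W),
    cg_split U ν c d (fun W => (¬ ∃ r ∈ ent, r ∈ W) ∧ ∃ r ∈ ent', r ∈ W) x,
    cg_split' U ν c d (fun W => (¬ ∃ r ∈ ent, r ∈ W) ∧ ∃ r ∈ ent', r ∈ W)] at FMx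
  rw [sum_entfree_split U ent ent' (fun W => ν W * c W * y W), sum_entfree_split U ent ent' (fun W => ν W * c W),
    cg_split U ν c d (fun W => (¬ ∃ r ∈ ent, r ∈ W) ∧ ∃ r ∈ ent', r ∈ W) y,
    cg_split' U ν c d (fun W => (¬ ∃ r ∈ ent, r ∈ W) ∧ ∃ r ∈ ent', r ∈ W)] at FMy
  rw [cg_split U ν c d (fun W => (¬ ∃ r ∈ ent, r ∈ W) ∧ ∃ r ∈ ent', r ∈ W) x,
    cg_split' U ν c d (fun W => (¬ ∃ r ∈ ent, r ∈ W) ∧ ∃ r ∈ ent', r ∈ W)] at FIDx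
  rw [cg_split U ν c d (fun W => (¬ ∃ r ∈ ent, r ∈ W) ∧ ∃ r ∈ ent', r ∈ W) y,
    cg_split' U ν c d (fun W => (¬ ∃ r ∈ ent, r ∈ W) ∧ ∃ r ∈ ent', r ∈ W)] at FIDy
  have FFKG := cg_fact_fkg_ideal U ent ent' ν c hν0 hν hc0 hcc x y hx0 hy0 hxm hym
  -- the scaled shifted variables
  have hsq : (0 : R) ≤ a * a := mul_nonneg ha.le ha.le
  have hJUx : 0 ≤ (a * XU - XI * u) * (a * a + a * δ) - (a * XJ - XI * δ) * (a * u) := by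
    have := mul_le_mul_of_nonneg_left FJUx hsq; linear_combination this
  have hJMx : 0 ≤ (a * XM - XI * t) * (a * a + a * δ) - (a * XJ - XI * δ) * (a * t) := by
    have := mul_le_mul_of_nonneg_left FJMx hsq; linear_combination this
  have hMcMx : 0 ≤ (a * XM - XI * t) * (a * a + a * δ + a * u) - ((a * XJ - XI * δ) + (a * XU - XI * u)) * (a * t) := by
    have := mul_le_mul_of_nonneg_left FMx hsq; linear_combination this
  have hJUy : 0 ≤ (a * YU - YI * u) * (a * a + a * δ) - (a * YJ - YI * δ) * (a * u) := by
    have := mul_le_mul_of_nonneg_left FJUy hsq; linear_combination this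
  have hJMy : 0 ≤ (a * YM - YI * t) * (a * a + a * δ) - (a * YJ - YI * δ) * (a * t) := by
    have := mul_le_mul_of_nonneg_left FJMy hsq; linear_combination this
  have hMcMy : 0 ≤ (a * YM - YI * t) * (a * a + a * δ + a * u) - ((a * YJ - YI * δ) + (a * YU - YI * u)) * (a * t) := by
    have := mul_le_mul_of_nonneg_left FMy hsq; linear_combination this
  have hXU' : 0 ≤ a * XU - XI * u := by linear_combination FIUx
  have hXM' : 0 ≤ a * XM - XI * t := by linear_combination FIMx
  have hYU' : 0 ≤ a * YU - YI * u := by linear_combination FIUy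
  have hYM' : 0 ≤ a * YM - YI * t := by linear_combination FIMy
  have hXJU' : 0 ≤ (a * XJ - XI * δ) + (a * XU - XI * u) := by linear_combination FIDx
  have hYJU' : 0 ≤ (a * YJ - YI * δ) + (a * YU - YI * u) := by linear_combination FIDy
  have hXJδ' : 0 ≤ a * δ - (a * XJ - XI * δ) := by
    linear_combination (mul_nonneg ha.le (sub_nonneg.2 hXJδ)) + (mul_nonneg hXI hδ)
  have hXUu' : 0 ≤ a * u - (a * XU - XI * u) := by
    linear_combination (mul_nonneg ha.le (sub_nonneg.2 hXUu)) + (mul_nonneg hXI hu)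
  have hXMt' : 0 ≤ a * t - (a * XM - XI * t) := by
    linear_combination (mul_nonneg ha.le (sub_nonneg.2 hXMt)) + (mul_nonneg hXI ht)
  have hsm : (0 : R) ≤ a * δ := mul_nonneg ha.le hδ
  have hsu : (0 : R) ≤ a * u := mul_nonneg ha.le hu
  have hst : (0 : R) ≤ a * t := mul_nonneg ha.le ht
  -- the parts term
  have hparts : 0 ≤ (a * a) * (a * a + a * δ + a * u + a * t) * ((a * XJ - XI * δ) + (a * XU - XI * u) + (a * XM - XI * t))
          * ((a * YJ - YI * δ) + (a * YU - YI * u) + (a * YM - YI * t))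
        - ((a * XJ - XI * δ) * (a * a + a * δ + a * u + a * t) - (a * δ) * ((a * XJ - XI * δ) + (a * XU - XI * u) + (a * XM - XI * t)))
          * ((a * YM - YI * t) * (a * a + a * δ + a * u + a * t) - (a * t) * ((a * YJ - YI * δ) + (a * YU - YI * u) + (a * YM - YI * t)))
        - ((a * YJ - YI * δ) * (a * a + a * δ + a * u + a * t) - (a * δ) * ((a * YJ - YI * δ) + (a * YU - YI * u) + (a * YM - YI * t)))
          * ((a * XM - XI * t) * (a * a + a * δ + a * u + a * t) - (a * t) * ((a * XJ - XI * δ) + (a * XU - XI * u) + (a * XM - XI * t))) := by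
    rcases le_or_gt 0 (a * XJ - XI * δ) with hXJ' | hXJ'
    · rcases le_or_gt 0 (a * YJ - YI * δ) with hYJ' | hYJ'
      · exact cg_parts (a * a) (a * δ) (a * u) (a * t) _ _ _ _ _ _ hsq hsu hst hXJ' hXU' hXM' hYJ' hYU' hYM'
          hJUx hJMx hMcMx hJUy hJMy hMcMy hXJδ' hXUu' hXMt'
      · have := cg_parts_onesided (a * a) (a * δ) (a * u) (a * t) _ _ _ _ _ _ hsq hsm hsu hst hYJ'.le hYJU' hYM'
          hXJU' hXM' hJUx hJMx hMcMy hMcMx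
        linear_combination this
    · exact cg_parts_onesided (a * a) (a * δ) (a * u) (a * t) _ _ _ _ _ _ hsq hsm hsu hst hXJ'.le hXJU' hXM'
        hYJU' hYM' hJUy hJMy hMcMx hMcMy
  have hfkg : 0 ≤ (a + δ + u + t) ^ 3 * a ^ 3 * (a * XYI - XI * YI) := by
    have h1 : 0 ≤ a * XYI - XI * YI := by linear_combination FFKG
    exact mul_nonneg (mul_nonneg (pow_nonneg (by linarith) 3) (pow_nonneg ha.le 3)) h1
  have key := cg_gen_identity a δ u t XI XJ XU XM YI YJ YU YM XYI
  have H : 0 ≤ a ^ 4 * ((a + δ + u + t) *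
        ((a + δ + u + t) * (a + δ + u + t) * XYI
          - (a + δ + u + t) * (YI + YJ + YU + YM) * XI
          - (a + δ + u + t) * (XI + XJ + XU + XM) * YI
          + (XI + XJ + XU + XM) * (YI + YJ + YU + YM) * a)
      - (((a + δ + u + t) * (XI + XU + XM) - (XI + XJ + XU + XM) * (a + u + t)) *
          ((a + δ + u + t) * (YI + YJ + YU) - (YI + YJ + YU + YM) * (a + δ + u))
        + ((a + δ + u + t) * (YI + YU + YM) - (YI + YJ + YU + YM) * (a + u + t)) *
          ((a + δ + u + t) * (XI + XJ + XU) - (XI + XJ + XU + XM) * (a + δ + u)))) := by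
    rw [key]; exact add_nonneg hfkg hparts
  have H2 := (mul_nonneg_iff_of_pos_left (pow_pos ha 4)).1 H
  linear_combination H2

end ClosedGateGenMain

section ClosedGateGenChain

variable {V : Type*} [DecidableEq V] {R : Type*} [Field R] [LinearOrder R] [IsStrictOrderedRing R]

/-- **THE GENERAL AND-SWITCH CHAIN AT THE CLOSED GATE, EVERY ENTRY STRUCTURE, EVERY PAIR OF
MARKERS** (nonnegative, increasing, `x ≤ 1`), at every `ρ ∈ [0, 1]`. -/
theorem chain_functional_nonneg_closed_gate_gen (U ent ent' : Finset V) (ν c d : Finset V → R)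
    (ρ : R) (hρ0 : 0 ≤ ρ) (hρ1 : ρ ≤ 1) (hν0 : ∀ W, 0 ≤ ν W)
    (hν : ∀ s ⊆ U, ∀ t ⊆ U, ν s * ν t ≤ ν (s ∩ t) * ν (s ∪ t))
    (hc0 : ∀ W, 0 ≤ c W) (hd0 : ∀ W, 0 ≤ d W) (hdc : ∀ W, d W ≤ c W)
    (hcc : ∀ s t, c s * c t ≤ c (s ∩ t) * c (s ∪ t))
    (hdd : ∀ s t, d s * d t ≤ d (s ∩ t) * d (s ∪ t))
    (hcd : ∀ s t, c s * d t ≤ c (s ∩ t) * d (s ∪ t))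
    (hratio : ∀ s t, s ⊆ t → d s * c t ≤ c s * d t)
    (x y : Finset V → R) (hx0 : ∀ W, 0 ≤ x W) (hy0 : ∀ W, 0 ≤ y W) (hx1 : ∀ W, x W ≤ 1)
    (hxm : ∀ s t, x s ≤ x (s ∪ t)) (hym : ∀ s t, y s ≤ y (s ∪ t))
    (hpos0 : 0 < ∑ W ∈ U.powerset, ν W * chainMix ent ent' 0 c d W)
    (hpos1 : 0 < ∑ W ∈ U.powerset, ν W * chainMix ent ent' 1 c d W)
    (hmI : 0 < ∑ W ∈ U.powerset.filter (fun W => ¬ ∃ r ∈ ent ∪ ent', r ∈ W), ν W * c W) :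
    0 ≤ (∑ W ∈ U.powerset, ν W * chainMix ent ent' ρ c d W) ^ 2 *
          (∑ W ∈ U.powerset, ν W * chainMix ent ent' ρ c (fun _ => (0 : R)) W * (x W * y W))
        - (∑ W ∈ U.powerset, ν W * chainMix ent ent' ρ c d W) *
          (∑ W ∈ U.powerset, ν W * chainMix ent ent' ρ c d W * x W) *
          (∑ W ∈ U.powerset, ν W * chainMix ent ent' ρ c (fun _ => (0 : R)) W * y W)
        - (∑ W ∈ U.powerset, ν W * chainMix ent ent' ρ c d W) *
          (∑ W ∈ U.powerset, ν W * chainMix ent ent' ρ c d W * y W) *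
          (∑ W ∈ U.powerset, ν W * chainMix ent ent' ρ c (fun _ => (0 : R)) W * x W)
        + (∑ W ∈ U.powerset, ν W * chainMix ent ent' ρ c d W * x W) *
          (∑ W ∈ U.powerset, ν W * chainMix ent ent' ρ c d W * y W) *
          (∑ W ∈ U.powerset, ν W * chainMix ent ent' ρ c (fun _ => (0 : R)) W) :=
  chain_functional_nonneg_of_XA' U ent ent' ν c d (fun _ => (0 : R)) ρ hρ0 hρ1 hν0 hν hc0 hd0
    (fun _ => le_rfl) hdc (fun W => hc0 W) (fun W => hd0 W) hcc hdd
    (fun _ _ => by simp) hcd (fun _ _ => by simp) (fun _ _ => by simp) hratio (fun _ _ _ => by simp)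
    x y hx0 hy0 hxm hym hpos0 hpos1 hmI
    (chain_XA'_closed_gate_gen U ent ent' ν c d hν0 hν hc0 hd0 hdc hcc hcd hratio x y hx0 hy0 hx1
      hxm hym hmI)

end ClosedGateGenChain

end Summit.Ventures.PercRepro2.Coin
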